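import Summits.CriticalPhenomena.PercolationContinuityZ3.Theorems.SahiMasterFamilyTerminalTightFour
import Summits.CriticalPhenomena.PercolationContinuityZ3.Theorems.SahiMasterFamilyCommonPivotalReaders

/-!
# Frame-field disjointness at order four, I: cored coordinates; witnesses of a core-free coordinate read by two glued frames

Unit `prim-master-conj` (crux anchor stmt-CriticalPhenomena-4575), gen 11; memo HOME/prim-master-conj/TIGHTNESS-III.md §7.
Towards `FrameFieldDisjoint` (the glued frames of a terminal quadruple have pairwise disjoint supports), in the glued-frame language:
* `mem_esupp_cframe_of_core` — in a structured family a coordinate in the CORE of a member lies in that member's block (T′);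
* `not_mem_esupp_gframe_of_core` — hence a cored coordinate lies in the glued block of its own member only;
* `Witness`, `TwoReaders` — two members `a ≠ b` whose glued frames both read a core-free `e`; pivotality witnesses never share a coordinate
  (`witness_disjoint`), can be enlarged outside the deletion-face block (`witness_enlarge`), lie inside the other reader's block
  (`witness_subset`); the two blocks cover `ι ∖ e` (`mem_esupp_or`), the other members have trivial deletion-face frame (`cframe_faceF_eq_univ`),
  `a` is pure there (`cframe_faceF_a`) with frame `OR` of its block (`mem_cframe_faceF_a_iff`) — TIGHTNESS §4.11(a) in Lean.
Part II (`SahiMasterFamilyFrameFieldDisjoint`) finishes: `frameFieldDisjoint_holds`, `terminalTight_one`, `masterFamilyIdentEqIff_four`.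
Pure combinatorics; axioms standard. [this work]
-/

noncomputable section

open scoped Classical

namespace Summit.CriticalPhenomena.PercolationContinuityZ3.Theorems

namespace GluedFrames

open Finset Function
open Literature.Probability.LatticeModels.Kahn2022 (Affects)
open PositiveSomewhere (orElse' mem_orElse' isUpperSet_orElse' not_mem_orElse'_iff secAt_true_orElse' mem_esupp_orElse'
  eq_orElse'_or_univ eq_univ_of_esupp_eq_empty' univ_diff_mem_of_not_mem_esupp' mem_esupp_cframe_of_core'
  empty_mem_gframe_of_singletons' not_mem_esupp_gframe_of_core')

variable {ι : Type*} [Fintype ι] {κ : Type*}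

/-! The generic lemmas of this development (`orElse'`, `eq_univ_of_esupp_eq_empty'`, `mem_esupp_cframe_of_core'`,
`empty_mem_gframe_of_singletons'`, `not_mem_esupp_gframe_of_core'`, …) were landed first — verbatim, primed — by the sister unit
`prim-masterthm-p4` in `SahiMasterFamilyCommonPivotalReaders` (namespace `PositiveSomewhere`); they are imported from there. -/

variable (U : κ → Set (Set ι)) (W : Finset κ)

/-! ### A core-free coordinate lies in at most one glued block -/

section TwoReaders

variable {U W}

/-- A (pivotality) WITNESS of `e` for the glued frame of `a`: an `e`-free non-empty configuration outside the frame whose `e`-enlargement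
is inside. [this work] -/
def Witness (U : κ → Set (Set ι)) (W : Finset κ) (e : ι) (a : κ) (ω : Set ι) : Prop :=
  ω.Nonempty ∧ e ∉ ω ∧ ω ∉ gframe U W a ∧ insert e ω ∈ gframe U W a

/-- Standing data: two distinct members whose glued frames read the core-free coordinate `e`. [this work] -/
structure TwoReaders (U : κ → Set (Set ι)) (W : Finset κ) (e : ι) (a b : κ) : Prop where
  hU : ∀ k, IsUpperSet (U k)
  hne : ∀ k, (U k).Nonempty
  hns : ∀ k, U k ≠ Set.univ
  hWU : ∀ k, k ∈ W
  hcard : W.card = 4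
  hS : ∀ h, Structured (faceT U h) W
  habs : ∀ l ∈ W, ∃ m ∈ W, m ≠ l ∧ ¬ U m ⊆ U l
  hι : ∀ f : ι, ∃ h, h ≠ f
  he : CoreFree U e
  hF : Structured (faceF U e) W
  hab : a ≠ b
  ha : e ∈ esupp (gframe U W a)
  hb : e ∈ esupp (gframe U W b)

namespace TwoReaders

variable {e : ι} {a b : κ} (D : TwoReaders U W e a b)
include D

/-- (auxiliary) `symm`. [this work] -/
theorem symm : TwoReaders U W e b a where
  hU := D.hU; hne := D.hne; hns := D.hns; hWU := D.hWU; hcard := D.hcard; hS := D.hS; habs := D.habs; hι := D.hι; he := D.he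
  hF := D.hF; hab := D.hab.symm; ha := D.hb; hb := D.ha


/-- The frames of the deletion face at `e` ("`B`") and their supports ("`S`"). -/
theorem notMem_esupp_B (j : κ) : ¬ Affects (cframe (faceF U e) W j) e := by
  have := not_affects_secAt e false (cframe (faceF U e) W j)
  rwa [cframe_faceF_ignores U W D.hU D.he D.hF (D.hWU j)] at this

/-- For `e`-free non-empty configurations, the glued frame and the deletion-face frame agree. [this work] -/
theorem mem_gframe_iff_mem_B {j : κ} {ω : Set ι} (hωne : ω.Nonempty) (heω : e ∉ ω) :
    ω ∈ cframe (faceF U e) W j ↔ ω ∈ gframe U W j := by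
  refine Iff.symm ?_
  obtain ⟨h, hh⟩ := hωne
  have hhe : h ≠ e := fun he' => heω (he' ▸ hh)
  rw [mem_cframe_faceF_iff U W D.hU D.hne D.hS D.he D.hF (D.hWU j) hh hhe, mem_secAt_false_iff_of_notMem heω]

/-- A member whose glued frame reads `e` has a witness. [this work] -/
theorem exists_witness {c : κ} (hc : e ∈ esupp (gframe U W c)) : ∃ ω, Witness U W e c ω := by
  obtain ⟨ω, hω, hωe⟩ := mem_esupp.1 hc
  have heω : e ∉ ω := fun h => hω (by rwa [Set.insert_eq_of_mem h] at hωe)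
  rcases Set.eq_empty_or_nonempty ω with rfl | hne'
  · rw [show insert e (∅ : Set ι) = {e} from by ext; simp] at hωe
    -- some singleton `{h}`, `h ≠ e`, is outside the glued frame (else `∅` would be inside)
    obtain ⟨h, hhe, hh⟩ : ∃ h, h ≠ e ∧ ({h} : Set ι) ∉ gframe U W c := by
      by_contra hall
      push Not at hall
      refine hω (empty_mem_gframe_of_singletons' U W D.hU D.hne D.hS (D.hWU c) fun h => ?_)
      by_cases hhe : h = e
      · subst hhe; exact hωe
      · exact hall h hhe
    refine ⟨{h}, Set.singleton_nonempty h, fun h' => hhe (Set.mem_singleton_iff.1 h').symm, hh, ?_⟩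
    exact isUpperSet_gframe U W D.hU c (by intro y hy; rw [Set.mem_singleton_iff] at hy; subst hy; simp) hωe
  · exact ⟨ω, hne', heω, hω, hωe⟩

/-- **Witnesses of the two readers never share a coordinate** (block-disjointness in the contraction face at the shared coordinate). [this work] -/
theorem witness_disjoint {ω ω' : Set ι} (hω : Witness U W e a ω) (hω' : Witness U W e b ω') {h : ι} (h1 : h ∈ ω) (h2 : h ∈ ω') :
    False := by
  have hΦU := isUpperSet_faceT U D.hU h
  have hΦne := faceT_nonempty U D.hU D.hne h
  have hreads : ∀ {c : κ} {χ : Set ι}, Witness U W e c χ → h ∈ χ → e ∈ esupp (cframe (faceT U h) W c) := by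
    intro c χ hχ hh
    rw [← secAt_true_gframe U W D.hU D.hne D.hS (D.hWU c) h, mem_esupp]
    refine ⟨χ, ?_, ?_⟩
    · rw [mem_secAt_true_iff_of_mem hh]; exact hχ.2.2.1
    · rw [mem_secAt_true_iff_of_mem (Set.mem_insert_of_mem e hh)]; exact hχ.2.2.2
  exact Finset.disjoint_left.1 (disjoint_esupp_cframe (faceT U h) hΦU hΦne (D.hS h) (D.hWU a) (D.hWU b) D.hab)
    (hreads hω h1) (hreads hω' h2)

/-- Enlarging a witness outside the block of its member (in the deletion face) gives a witness. [this work] -/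
theorem witness_enlarge {c : κ} {ω : Set ι} (hω : Witness U W e c ω) :
    Witness U W e c (ω ∪ {y | y ∉ esupp (cframe (faceF U e) W c) ∧ y ≠ e}) := by
  have hne' : (ω ∪ {y | y ∉ esupp (cframe (faceF U e) W c) ∧ y ≠ e}).Nonempty := hω.1.mono Set.subset_union_left
  have he' : e ∉ ω ∪ {y | y ∉ esupp (cframe (faceF U e) W c) ∧ y ≠ e} := by
    rintro (h | h)
    · exact hω.2.1 h
    · exact h.2 rfl
  refine ⟨hne', he', fun hmem => hω.2.2.1 ?_, isUpperSet_gframe U W D.hU c (Set.insert_subset_insert Set.subset_union_left) hω.2.2.2⟩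
  -- membership of `e`-free non-empty configurations is read in the deletion-face frame, which only sees its own block
  rw [← D.mem_gframe_iff_mem_B hω.1 hω.2.1]
  rw [← D.mem_gframe_iff_mem_B hne' he'] at hmem
  refine (mem_iff_of_inter_esupp_eq (isUpperSet_cframe (faceF U e) (isUpperSet_faceF U D.hU e) W c) ?_).2 hmem
  ext y; constructor
  · rintro ⟨hy, hys⟩; exact ⟨Or.inl hy, hys⟩
  · rintro ⟨hy | hy, hys⟩
    · exact ⟨hy, hys⟩
    · exact absurd (mem_coe.1 hys) hy.1

/-- **Every witness of `a` lies inside the block of `b`** (in the deletion face at `e`). [this work] -/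
theorem witness_subset {ω : Set ι} (hω : Witness U W e a ω) : ω ⊆ ↑(esupp (cframe (faceF U e) W b)) := by
  obtain ⟨ω', hω'⟩ := D.symm.exists_witness D.hb
  have hbig := D.symm.witness_enlarge hω'
  intro y hy
  by_contra hyS
  have hye : y ≠ e := fun h => hω.2.1 (h ▸ hy)
  exact D.witness_disjoint hω hbig hy (Or.inr ⟨hyS, hye⟩)

/-- **The blocks of `a` and `b` in the deletion face cover every coordinate but `e`.** [this work] -/
theorem mem_esupp_or {y : ι} (hye : y ≠ e) : y ∈ esupp (cframe (faceF U e) W b) ∨ y ∈ esupp (cframe (faceF U e) W a) := by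
  by_contra hnot
  rw [not_or] at hnot
  obtain ⟨ω, hω⟩ := D.exists_witness D.ha
  obtain ⟨ω', hω'⟩ := D.symm.exists_witness D.hb
  exact D.witness_disjoint (D.witness_enlarge hω) (D.symm.witness_enlarge hω') (h := y) (Or.inr ⟨hnot.2, hye⟩) (Or.inr ⟨hnot.1, hye⟩)

/-- The other members have the trivial frame in the deletion face. [this work] -/
theorem cframe_faceF_eq_univ {m : κ} (hma : m ≠ a) (hmb : m ≠ b) : Set.univ = cframe (faceF U e) W m := by
  refine Eq.symm <| eq_univ_of_esupp_eq_empty' (isUpperSet_cframe _ (isUpperSet_faceF U D.hU e) W m)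
    ⟨_, subset_cframe _ (isUpperSet_faceF U D.hU e) W m (univ_mem_of_nonempty ((isUpperSet_faceF U D.hU e) m) ((faceF_nonempty U D.he) m))⟩ (eq_empty_of_forall_notMem fun y hy => ?_)
  have hye : y ≠ e := fun h => D.notMem_esupp_B m (mem_esupp.1 (h ▸ hy))
  rcases D.mem_esupp_or hye with h | h
  · exact Finset.disjoint_left.1 (disjoint_esupp_cframe _ (isUpperSet_faceF U D.hU e) (faceF_nonempty U D.he) D.hF (D.hWU m) (D.hWU b) hmb) hy h
  · exact Finset.disjoint_left.1 (disjoint_esupp_cframe _ (isUpperSet_faceF U D.hU e) (faceF_nonempty U D.he) D.hF (D.hWU m) (D.hWU a) hma) hy h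

/-- A deletion face of a non-sure event is not everything. [this work] -/
theorem faceF_ne_univ (m : κ) : (∅ : Set ι) ∉ faceF U e m := by
  intro this
  rw [faceF_apply, mem_secAt] at this
  simp only [forceAt, cond_false, Set.empty_sdiff] at this
  exact D.hns m (Set.eq_univ_of_forall fun ω => D.hU m (Set.empty_subset ω) this)

/-- `a` is pure in the deletion face: its frame there is the member. [this work] -/
theorem cframe_faceF_a : faceF U e a = cframe (faceF U e) W a := by
  refine Eq.symm ?_
  obtain ⟨p, hp, q, hq, hpq, hfp, hfq⟩ := exists_two_pure (faceF U e) (isUpperSet_faceF U D.hU e) (faceF_nonempty U D.he) D.hF (by rw [D.hcard]; norm_num)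
  have key : ∀ {m}, cframe (faceF U e) W m = faceF U e m → m = a ∨ m = b := by
    intro m hm
    by_contra h; rw [not_or] at h
    exact D.faceF_ne_univ m (by rw [← hm, ← D.cframe_faceF_eq_univ h.1 h.2]; exact Set.mem_univ _)
  rcases key hfp with rfl | rfl
  · exact hfp
  · rcases key hfq with rfl | hqb
    · exact hfq
    · exact absurd hqb.symm (by rintro rfl; exact hpq rfl)

/-- **The frame of `a` in the deletion face is `OR` of its block.** [this work] -/
theorem mem_cframe_faceF_a_iff (ω : Set ι) :
    (∃ y ∈ ω, y ∈ esupp (cframe (faceF U e) W a)) ↔ ω ∈ cframe (faceF U e) W a := by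
  refine Iff.symm ?_
  obtain ⟨ωa, hωa⟩ := D.exists_witness D.ha
  have hBa := isUpperSet_cframe (faceF U e) (isUpperSet_faceF U D.hU e) W a
  have hωaS : ∀ y ∈ ωa, y ∉ esupp (cframe (faceF U e) W a) := fun y hy hyS =>
    Finset.disjoint_left.1 (disjoint_esupp_cframe _ (isUpperSet_faceF U D.hU e) (faceF_nonempty U D.he) D.hF (D.hWU a) (D.hWU b) D.hab) hyS (D.witness_subset hωa hy)
  have hωaB : ωa ∉ cframe (faceF U e) W a := fun h => hωa.2.2.1 ((D.mem_gframe_iff_mem_B hωa.1 hωa.2.1).1 h)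
  constructor
  · intro hω
    by_contra hnone
    push Not at hnone
    apply hωaB
    refine (mem_iff_of_inter_esupp_eq hBa (ω := ωa) (ω' := ω) ?_).2 hω
    ext y; constructor
    · rintro ⟨hy, hys⟩; exact absurd (mem_coe.1 hys) (hωaS y hy)
    · rintro ⟨hy, hys⟩; exact absurd (mem_coe.1 hys) (hnone y hy)
  · rintro ⟨y, hy, hyS⟩
    -- `ωa ∪ (ω ∩ S_a)` lies in the glued frame (else it would be a witness inside `S_b`), and has the same `S_a`-trace as `ω`
    set ω' : Set ι := ωa ∪ (ω ∩ ↑(esupp (cframe (faceF U e) W a))) with hω'def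
    have hne' : ω'.Nonempty := hωa.1.mono Set.subset_union_left
    have he' : e ∉ ω' := by
      rintro (h | ⟨-, h⟩)
      · exact hωa.2.1 h
      · exact D.notMem_esupp_B a (mem_esupp.1 (mem_coe.1 h))
    have hω'G : ω' ∈ gframe U W a := by
      by_contra hnot
      have hw : Witness U W e a ω' := ⟨hne', he', hnot, isUpperSet_gframe U W D.hU a (Set.insert_subset_insert Set.subset_union_left) hωa.2.2.2⟩
      have := D.witness_subset hw (Or.inr ⟨hy, mem_coe.2 hyS⟩)
      exact Finset.disjoint_left.1 (disjoint_esupp_cframe _ (isUpperSet_faceF U D.hU e) (faceF_nonempty U D.he) D.hF (D.hWU a) (D.hWU b) D.hab) hyS (mem_coe.1 this)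
    have hω'B := (D.mem_gframe_iff_mem_B hne' he').2 hω'G
    refine (mem_iff_of_inter_esupp_eq hBa (ω := ω) (ω' := ω') ?_).2 hω'B
    ext z; constructor
    · rintro ⟨hz, hzs⟩; exact ⟨Or.inr ⟨hz, hzs⟩, hzs⟩
    · rintro ⟨hz | ⟨hz, -⟩, hzs⟩
      · exact absurd (mem_coe.1 hzs) (hωaS z hz)
      · exact ⟨hz, hzs⟩

/-- The block of `a` in the deletion face is non-empty. [this work] -/
theorem esupp_cframe_faceF_a_nonempty : esupp (cframe (faceF U e) W a) ≠ ∅ := by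
  intro h
  have := eq_univ_of_esupp_eq_empty' (isUpperSet_cframe _ (isUpperSet_faceF U D.hU e) W a)
    ⟨_, subset_cframe _ (isUpperSet_faceF U D.hU e) W a (univ_mem_of_nonempty ((isUpperSet_faceF U D.hU e) a) ((faceF_nonempty U D.he) a))⟩ h
  exact D.faceF_ne_univ a (by rw [D.cframe_faceF_a, this]; exact Set.mem_univ _)

end TwoReaders

end TwoReaders

end GluedFrames

end Summit.CriticalPhenomena.PercolationContinuityZ3.Theorems
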